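import Summits.QuantumAdvantage.QuantumAdvantage.Theorems.CubicForrelationNearExactIsExactTwelveLevelFiveRigid
import Summits.QuantumAdvantage.QuantumAdvantage.Theorems.CubicForrelationNearExactIsExactFlatSecondWeight

/-!
# Crux `CubicForrelation.NearExactIsExact` (stmt-QuantumAdvantage-14043) — n = 12, open window `(57/64, 29/32)`, a LEVEL-5 side in the RIGID
  case with `4 ∣ e₅` off the odd hyperplane: `L₅` IS A 7-FLAT OF EXACTLY `128` POINTS

Certificate seat `b2b-cforr-cert` (gen 29).  HONEST FRAMING: kernel-checked finite-slice lemmas (standard axioms) about cubic Boolean pairs on 12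
bits; they sharpen …TwelveLevelFiveRigid (`128 ≤ #L₅ ≤ 191`, a Pfaffian frame) to the EXACT shape gens 22–23 had only at `Φ = 29/32` with an
exact budget: on the whole open window a rigid level-5 side with `4 ∣ e₅` off `P` has `L₅ = {x ∈ P : e₅ ≢ σ₅ (mod 8)} = t₀ ⊕ R₇`, a coset of an
xor-closed `R₇ ⊆ V` with `#R₇ = 128`.  NO value of `θ₁₂` is claimed, nothing else is excluded; NOT summit progress.
Plan: HOME/b2b-cforr-cert-g27/PLAN-N12-WINDOW-O5.md §A (rigid: "`#L₅ = 128`, a 7-flat — relative K–T for `r = 4` is TODO"); the TODO is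
…FlatSecondWeight (this gen).

THE ARGUMENT.  By `tzr_parity` the parity of a parametrised 4-flat section count `N(x; a₀,…,a₃)` of `L₅` (`x ∈ P`, `aᵢ ∈ V`) is the Pfaffian
`Pf(a)` — INDEPENDENT OF THE BASE `x`.  A parametrised 5-flat `x ⊕ ⟨a₀,…,a₄⟩` is the 4-flat `x ⊕ ⟨a₁,…,a₄⟩` plus its translate by `a₀`, two
counts of equal parity: so every 5-flat section count of `L₅` is EVEN (`ffw_even_succ_of_parity`, `tzq_flat5_even`), i.e. `1_{L₅}` has relative
degree `≤ 4` on the 11-flat `P`.  Hence `#L₅ ≥ 2^{11−4} = 128` (`erm_weight_ge`, a frame-free second proof of `tzr_L5_card_ge`), and since the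
window budget gives `#L₅ ≤ 191 < 192 = 3·2^{11−4}/2`, the relative Kasami–Tokura second weight (`ffw_second_weight`, `r = 4`) forces `#L₅ = 128`
EXACTLY, and a relative minimum-weight word is a flat (`ffw_minweight_flat`, `d = 3`): `L₅ = t₀ ⊕ R₇`.
* `ffw_even_succ_of_parity` (pure flat combinatorics): base-independent parity of the `k`-flat counts ⇒ even `(k+1)`-flat counts.
* `tzq_flat5_even`, `tzq_L5_card`, `tzq_L5_flat`, and the window packaging `tzq_window_rigid_flat` (`L₅ = t₀ ⊕ R₇`, `#R₇ = 128`, `Σ_P (e₅² − 1) ≥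
  1024`, off-hyperplane energy `≤ 511`, total slack `≤ 1535`).

References: T. Kasami, N. Tokura (1970) Thm 1; MacWilliams–Sloane (1977) Ch. 13 §3, Ch. 15 §2; J. Ax (1964) / R. J. McEliece (1972).  Axioms: the
standard three.
-/

set_option linter.dupNamespace false -- D-0017: single-problem summit ⇒ `QuantumAdvantage.QuantumAdvantage` by design

noncomputable section

namespace Summit.QuantumAdvantage.QuantumAdvantage.Theorems.CubicForrelation.NearExactIsExact

open Finset
open Literature.Computability.QuantumComplexity
open Literature.Computability.QuantumComplexity.BuzetChailloux (bxor zeroVec bxor_bxor_cancel_left bxor_zeroVec zeroVec_bxor bxor_comm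
  bxor_self)
open Literature.Computability.QuantumComplexity.DerivativeWalsh (W)

variable {n : ℕ}

/-! ### Flat combinatorics: base-free parity one dimension up -/

/-- **Base-independent parity of the `k`-flat counts ⇒ even `(k+1)`-flat counts.**  Let `S` be xor-closed, `c` a point, `hd` a Boolean function.
If for all bases `x, y` of the coset `c ⊕ S` and every `k`-frame `a` of directions in `S` the counts `#{ε : hd(x ⊕ ε·a)}` and `#{ε : hd(y ⊕ ε·a)}`
have the same parity, then every parametrised `(k+1)`-flat count (base in `c ⊕ S`, directions in `S`) is even: the `(k+1)`-flat is the `k`-flat of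
the last `k` directions together with its translate by the first one. [folklore] -/
theorem ffw_even_succ_of_parity (S : Finset (Fin n → Bool)) (hadd : ∀ x ∈ S, ∀ y ∈ S, bxor x y ∈ S) (c : Fin n → Bool)
    (hd : (Fin n → Bool) → Bool) {k : ℕ}
    (hpar : ∀ x ∈ S.image (bxor c), ∀ y ∈ S.image (bxor c), ∀ a : Fin k → Fin n → Bool, (∀ i, a i ∈ S) →
      (Even #(univ.filter fun ε : Fin k → Bool => hd (fun j => x j ^^ decide (Odd #(univ.filter fun i => ε i && a i j))) = true) ↔
        Even #(univ.filter fun ε : Fin k → Bool => hd (fun j => y j ^^ decide (Odd #(univ.filter fun i => ε i && a i j))) = true))) :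
    ∀ x ∈ S.image (bxor c), ∀ a : Fin (k + 1) → Fin n → Bool, (∀ i, a i ∈ S) →
      Even #(univ.filter fun ε : Fin (k + 1) → Bool => hd (fun j => x j ^^ decide (Odd #(univ.filter fun i => ε i && a i j))) = true) := by
  classical
  intro b hb' a ha
  have ea : a = Fin.cons (a 0) (Fin.tail a) := (Fin.cons_self_tail a).symm
  rw [erm_card_split]
  have hfalse : (univ.filter fun ε : Fin k → Bool =>
      hd (fun j => b j ^^ decide (Odd #(univ.filter fun i => (Fin.cons false ε : Fin (k + 1) → Bool) i && a i j))) = true) =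
      univ.filter fun ε : Fin k → Bool =>
        hd (fun j => b j ^^ decide (Odd #(univ.filter fun i => ε i && Fin.tail a i j))) = true := by
    refine filter_congr fun ε _ => ?_
    conv_lhs => rw [ea, erm_flatPt_cons]
    simp only [Bool.false_and, Bool.xor_false, Fin.tail]
  have htrue : (univ.filter fun ε : Fin k → Bool =>
      hd (fun j => b j ^^ decide (Odd #(univ.filter fun i => (Fin.cons true ε : Fin (k + 1) → Bool) i && a i j))) = true) =
      univ.filter fun ε : Fin k → Bool =>
        hd (fun j => (bxor b (a 0)) j ^^ decide (Odd #(univ.filter fun i => ε i && Fin.tail a i j))) = true := by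
    refine filter_congr fun ε _ => ?_
    conv_lhs => rw [ea, erm_flatPt_cons]
    simp only [Bool.true_and, Fin.tail, bxor]
    have e : (fun j => (b j ^^ decide (Odd #(univ.filter fun i : Fin k => ε i && a i.succ j))) ^^ a 0 j) =
        fun j => (b j ^^ a 0 j) ^^ decide (Odd #(univ.filter fun i : Fin k => ε i && a i.succ j)) := by
      funext j
      cases b j <;> cases a 0 j <;> cases decide (Odd #(univ.filter fun i : Fin k => ε i && a i.succ j)) <;> rfl
    rw [e]
  rw [hfalse, htrue]
  have hb2 : bxor b (a 0) ∈ S.image (bxor c) := by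
    obtain ⟨s, hs, rfl⟩ := mem_image.1 hb'
    exact mem_image.2 ⟨bxor s (a 0), hadd s hs (a 0) (ha 0), by rw [iw_bxor_assoc]⟩
  rcases Nat.even_or_odd #(univ.filter fun ε : Fin k → Bool =>
      hd (fun j => b j ^^ decide (Odd #(univ.filter fun i => ε i && Fin.tail a i j))) = true) with h1 | h1
  · exact h1.add ((hpar b hb' (bxor b (a 0)) hb2 (Fin.tail a) fun i => ha _).1 h1)
  · refine Nat.even_add'.2 ⟨fun _ => ?_, fun _ => h1⟩
    rcases Nat.even_or_odd #(univ.filter fun ε : Fin k → Bool =>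
        hd (fun j => (bxor b (a 0)) j ^^ decide (Odd #(univ.filter fun i => ε i && Fin.tail a i j))) = true) with h2 | h2
    · exact absurd ((hpar b hb' (bxor b (a 0)) hb2 (Fin.tail a) fun i => ha _).2 h2) (Nat.not_even_iff_odd.2 h1)
    · exact h2

/-! ### `L₅` has relative degree `≤ 4` on the odd hyperplane -/

/-- **Even 5-flat sections of `L₅`.**  In the rigid bookkeeping of …TwelveLevelFiveRigid (`4 ∣ e₅` off `P`, off-hyperplane energy `≤ 2047`):
every parametrised 5-flat of `P` (base in `P`, directions in `V`) meets `L₅ = {e₅ ≢ σ₅ (mod 8)}` in an even number of parameters — the two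
4-flat halves have the same (Pfaffian) parity by `tzr_parity`. [this work] -/
theorem tzq_flat5_even (f g : (Fin (6 + 6) → Bool) → Bool) (hf : IsDegLeFun 3 f) (hg : IsDegLeFun 3 g)
    (u' : (Fin (6 + 6) → Bool) → ℤ) (hu' : ∀ x, W (fun y => signOf (g y)) x = (2 : ℝ) ^ 5 * (u' x : ℝ))
    (V : Finset (Fin (6 + 6) → Bool)) (x₀ : Fin (6 + 6) → Bool) (h0 : zeroVec ∈ V) (hadd : ∀ a ∈ V, ∀ b ∈ V, bxor a b ∈ V)
    (hcardV : #V = 2048) (hP : (univ.filter fun x : Fin (6 + 6) → Bool => Odd (u' x)) = V.image (bxor x₀))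
    (h4off : ∀ y, ¬ Odd (u' y) → (4 : ℤ) ∣ u' y - 2 * sZ (f y))
    (hoff : ∑ y ∈ univ.filter (fun y : Fin (6 + 6) → Bool => ¬ Odd (u' y)), (u' y - 2 * sZ (f y)) ^ 2 ≤ 2047)
    (hb : (Fin (6 + 6) → Bool) → Bool) (hhb : ∀ z, hb z = decide ((u' z - 2 * sZ (f z)) % 4 = 3)) :
    ∀ b ∈ V.image (bxor x₀), ∀ a : Fin (4 + 1) → Fin (6 + 6) → Bool, (∀ i, a i ∈ V) →
      Even #(univ.filter fun ε : Fin (4 + 1) → Bool =>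
        decide (¬ (8 : ℤ) ∣ u' (fun j => b j ^^ decide (Odd #(univ.filter fun i => ε i && a i j))) - 2 * sZ (f (fun j => b j ^^ decide (Odd #(univ.filter fun i => ε i && a i j)))) - sZ (hb (fun j => b j ^^ decide (Odd #(univ.filter fun i => ε i && a i j))))) = true) := by
  classical
  have hmemP : ∀ x, x ∈ V.image (bxor x₀) ↔ Odd (u' x) := fun x => by rw [← hP]; simp
  refine ffw_even_succ_of_parity V hadd x₀ (fun z => decide (¬ (8 : ℤ) ∣ u' z - 2 * sZ (f z) - sZ (hb z))) ?_
  intro x hx y hy a ha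
  have ea : a = ![a 0, a 1, a 2, a 3] := by funext i; fin_cases i <;> rfl
  have hx' := tzr_parity f g hf hg u' hu' V x₀ h0 hadd hcardV hP h4off hoff hb hhb ((hmemP x).1 hx) (ha 0) (ha 1) (ha 2) (ha 3)
  have hy' := tzr_parity f g hf hg u' hu' V x₀ h0 hadd hcardV hP h4off hoff hb hhb ((hmemP y).1 hy) (ha 0) (ha 1) (ha 2) (ha 3)
  rw [← ea] at hx' hy'
  have ex : (univ.filter fun ε : Fin 4 → Bool => decide (¬ (8 : ℤ) ∣ u' (fun j => x j ^^ decide (Odd #(univ.filter fun i => ε i && a i j))) - 2 * sZ (f (fun j => x j ^^ decide (Odd #(univ.filter fun i => ε i && a i j)))) - sZ (hb (fun j => x j ^^ decide (Odd #(univ.filter fun i => ε i && a i j))))) = true) =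
      univ.filter fun ε : Fin 4 → Bool => ¬ (8 : ℤ) ∣ u' (fun j => x j ^^ decide (Odd #(univ.filter fun i => ε i && a i j))) - 2 * sZ (f (fun j => x j ^^ decide (Odd #(univ.filter fun i => ε i && a i j)))) - sZ (hb (fun j => x j ^^ decide (Odd #(univ.filter fun i => ε i && a i j)))) :=
    filter_congr fun ε _ => by simp only [decide_eq_true_eq]
  have ey : (univ.filter fun ε : Fin 4 → Bool => decide (¬ (8 : ℤ) ∣ u' (fun j => y j ^^ decide (Odd #(univ.filter fun i => ε i && a i j))) - 2 * sZ (f (fun j => y j ^^ decide (Odd #(univ.filter fun i => ε i && a i j)))) - sZ (hb (fun j => y j ^^ decide (Odd #(univ.filter fun i => ε i && a i j))))) = true) =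
      univ.filter fun ε : Fin 4 → Bool => ¬ (8 : ℤ) ∣ u' (fun j => y j ^^ decide (Odd #(univ.filter fun i => ε i && a i j))) - 2 * sZ (f (fun j => y j ^^ decide (Odd #(univ.filter fun i => ε i && a i j)))) - sZ (hb (fun j => y j ^^ decide (Odd #(univ.filter fun i => ε i && a i j)))) :=
    filter_congr fun ε _ => by simp only [decide_eq_true_eq]
  rw [ex, ey, hx', hy']

/-- **`#L₅ = 128` on the window budget** (relative Kasami–Tokura for order 4 on the 11-flat `P`): `L₅ ≠ ∅` and `Σ_P (e₅² − 1) ≤ 1535` ⇒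
`#L₅ = 128`. [this work] -/
theorem tzq_L5_card (f g : (Fin (6 + 6) → Bool) → Bool) (hf : IsDegLeFun 3 f) (hg : IsDegLeFun 3 g)
    (u' : (Fin (6 + 6) → Bool) → ℤ) (hu' : ∀ x, W (fun y => signOf (g y)) x = (2 : ℝ) ^ 5 * (u' x : ℝ))
    (V : Finset (Fin (6 + 6) → Bool)) (x₀ : Fin (6 + 6) → Bool) (h0 : zeroVec ∈ V) (hadd : ∀ a ∈ V, ∀ b ∈ V, bxor a b ∈ V)
    (hcardV : #V = 2048) (hP : (univ.filter fun x : Fin (6 + 6) → Bool => Odd (u' x)) = V.image (bxor x₀))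
    (h4off : ∀ y, ¬ Odd (u' y) → (4 : ℤ) ∣ u' y - 2 * sZ (f y))
    (hoff : ∑ y ∈ univ.filter (fun y : Fin (6 + 6) → Bool => ¬ Odd (u' y)), (u' y - 2 * sZ (f y)) ^ 2 ≤ 2047)
    (hb : (Fin (6 + 6) → Bool) → Bool) (hhb : ∀ z, hb z = decide ((u' z - 2 * sZ (f z)) % 4 = 3))
    (hbud : ∑ x ∈ univ.filter (fun x : Fin (6 + 6) → Bool => Odd (u' x)), ((u' x - 2 * sZ (f x)) ^ 2 - 1) ≤ 1535)
    (hL : ∃ x, Odd (u' x) ∧ ¬ (8 : ℤ) ∣ u' x - 2 * sZ (f x) - sZ (hb x)) :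
    #(univ.filter fun z : Fin (6 + 6) → Bool => Odd (u' z) ∧ ¬ (8 : ℤ) ∣ u' z - 2 * sZ (f z) - sZ (hb z)) = 128 := by
  classical
  set e : (Fin (6 + 6) → Bool) → ℤ := fun z => u' z - 2 * sZ (f z) with hedef
  set P := univ.filter (fun x : Fin (6 + 6) → Bool => Odd (u' x)) with hPdef
  set hd : (Fin (6 + 6) → Bool) → Bool := fun z => decide (¬ (8 : ℤ) ∣ e z - sZ (hb z)) with hddef
  have hmemP : ∀ x, x ∈ V.image (bxor x₀) ↔ Odd (u' x) := fun x => by rw [← hP]; simp [hPdef]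
  have hcardV11 : #V = 2 ^ 11 := by rw [hcardV]; norm_num
  have hflat := tzq_flat5_even f g hf hg u' hu' V x₀ h0 hadd hcardV hP h4off hoff hb hhb
  -- the support of `hd` on the coset is `L₅`
  have hsupp : ((V.image (bxor x₀)).filter fun z => hd z = true) = (univ.filter fun z : Fin (6 + 6) → Bool => Odd (u' z) ∧ ¬ (8 : ℤ) ∣ u' z - 2 * sZ (f z) - sZ (hb z)) := by
    rw [← hP]
    ext z
    simp only [hPdef, mem_filter, mem_univ, true_and, hd, e, decide_eq_true_eq]
  obtain ⟨x, hx, hxL⟩ := hL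
  have hne : ∃ z ∈ V.image (bxor x₀), hd z = true := ⟨x, (hmemP x).2 hx, by simp [hd, e]; exact hxL⟩
  -- `#L₅ ≤ 191` from the budget
  set T := (univ.filter fun z : Fin (6 + 6) → Bool => Odd (u' z) ∧ ¬ (8 : ℤ) ∣ u' z - 2 * sZ (f z) - sZ (hb z)) with hTdef
  have hTsub : T ⊆ P := fun z hz => mem_filter.2 ⟨mem_univ _, (mem_filter.1 hz).2.1⟩
  have hTcost : ∀ z ∈ T, (8 : ℤ) ≤ e z ^ 2 - 1 := by
    intro z hz
    obtain ⟨-, hz1, hz2⟩ := mem_filter.1 hz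
    have h9 := tzr_cost f u' hb hhb hz1 hz2
    simp only [e]; linarith
  have heodd : ∀ z, Odd (u' z) → Odd (e z) := fun z hz => Int.odd_sub.2 (iff_of_true hz ⟨sZ (f z), two_mul _⟩)
  have hPnn : ∀ z ∈ P, (0 : ℤ) ≤ e z ^ 2 - 1 := fun z hz => by
    have h0' := Int.odd_iff.1 (heodd z (mem_filter.1 hz).2)
    have : e z ≤ -1 ∨ 1 ≤ e z := by omega
    rcases this with h | h <;> nlinarith
  have hTle : 8 * (#T : ℤ) ≤ ∑ z ∈ P, (e z ^ 2 - 1) :=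
    calc 8 * (#T : ℤ) = ∑ z ∈ T, (8 : ℤ) := by rw [sum_const, nsmul_eq_mul, mul_comm]
      _ ≤ ∑ z ∈ T, (e z ^ 2 - 1) := sum_le_sum hTcost
      _ ≤ ∑ z ∈ P, (e z ^ 2 - 1) := sum_le_sum_of_subset_of_nonneg hTsub fun z hz _ => hPnn z hz
  have hbud' : ∑ z ∈ P, (e z ^ 2 - 1) ≤ 1535 := hbud
  have h191 : #T ≤ 191 := by
    have : (#T : ℤ) ≤ 191 := by linarith
    exact_mod_cast this
  have hlt : 2 ^ (4 + 1) * #((V.image (bxor x₀)).filter fun z => hd z = true) < 3 * 2 ^ 11 := by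
    rw [hsupp]; norm_num; omega
  have hsw := ffw_second_weight (r := 4) (m := 11) (by norm_num) V h0 hadd hcardV11 x₀ hd hflat hne hlt
  rw [hsupp] at hsw
  norm_num at hsw
  omega

/-- **`L₅` is a 7-flat.**  Under the same hypotheses `L₅ = t ⊕ R₇` for every `t ∈ L₅`, where `R₇ ⊆ V` is xor-closed with `#R₇ = 128 = #L₅`, and
translation by `R₇` preserves membership in `L₅` along `P`. [this work] -/
theorem tzq_L5_flat (f g : (Fin (6 + 6) → Bool) → Bool) (hf : IsDegLeFun 3 f) (hg : IsDegLeFun 3 g)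
    (u' : (Fin (6 + 6) → Bool) → ℤ) (hu' : ∀ x, W (fun y => signOf (g y)) x = (2 : ℝ) ^ 5 * (u' x : ℝ))
    (V : Finset (Fin (6 + 6) → Bool)) (x₀ : Fin (6 + 6) → Bool) (h0 : zeroVec ∈ V) (hadd : ∀ a ∈ V, ∀ b ∈ V, bxor a b ∈ V)
    (hcardV : #V = 2048) (hP : (univ.filter fun x : Fin (6 + 6) → Bool => Odd (u' x)) = V.image (bxor x₀))
    (h4off : ∀ y, ¬ Odd (u' y) → (4 : ℤ) ∣ u' y - 2 * sZ (f y))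
    (hoff : ∑ y ∈ univ.filter (fun y : Fin (6 + 6) → Bool => ¬ Odd (u' y)), (u' y - 2 * sZ (f y)) ^ 2 ≤ 2047)
    (hb : (Fin (6 + 6) → Bool) → Bool) (hhb : ∀ z, hb z = decide ((u' z - 2 * sZ (f z)) % 4 = 3))
    (hbud : ∑ x ∈ univ.filter (fun x : Fin (6 + 6) → Bool => Odd (u' x)), ((u' x - 2 * sZ (f x)) ^ 2 - 1) ≤ 1535)
    (hL : ∃ x, Odd (u' x) ∧ ¬ (8 : ℤ) ∣ u' x - 2 * sZ (f x) - sZ (hb x)) :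
    #(univ.filter fun z : Fin (6 + 6) → Bool => Odd (u' z) ∧ ¬ (8 : ℤ) ∣ u' z - 2 * sZ (f z) - sZ (hb z)) = 128 ∧
    ∃ R₇ : Finset (Fin (6 + 6) → Bool), R₇ ⊆ V ∧ zeroVec ∈ R₇ ∧ (∀ a ∈ R₇, ∀ b ∈ R₇, bxor a b ∈ R₇) ∧ #R₇ = 128 ∧
      (∀ r ∈ R₇, ∀ x, Odd (u' x) →
        (¬ (8 : ℤ) ∣ u' (bxor x r) - 2 * sZ (f (bxor x r)) - sZ (hb (bxor x r)) ↔ ¬ (8 : ℤ) ∣ u' x - 2 * sZ (f x) - sZ (hb x))) ∧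
      ∀ t, Odd (u' t) → ¬ (8 : ℤ) ∣ u' t - 2 * sZ (f t) - sZ (hb t) →
        (univ.filter fun z : Fin (6 + 6) → Bool => Odd (u' z) ∧ ¬ (8 : ℤ) ∣ u' z - 2 * sZ (f z) - sZ (hb z)) = R₇.image (bxor t) := by
  classical
  set e : (Fin (6 + 6) → Bool) → ℤ := fun z => u' z - 2 * sZ (f z) with hedef
  set hd : (Fin (6 + 6) → Bool) → Bool := fun z => decide (¬ (8 : ℤ) ∣ e z - sZ (hb z)) with hddef
  have hmemP : ∀ x, x ∈ V.image (bxor x₀) ↔ Odd (u' x) := fun x => by rw [← hP]; simp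
  have hcardV11 : #V = 2 ^ 11 := by rw [hcardV]; norm_num
  have h128 := tzq_L5_card f g hf hg u' hu' V x₀ h0 hadd hcardV hP h4off hoff hb hhb hbud hL
  have hflat := tzq_flat5_even f g hf hg u' hu' V x₀ h0 hadd hcardV hP h4off hoff hb hhb
  have hsupp : ((V.image (bxor x₀)).filter fun z => hd z = true) = (univ.filter fun z : Fin (6 + 6) → Bool => Odd (u' z) ∧ ¬ (8 : ℤ) ∣ u' z - 2 * sZ (f z) - sZ (hb z)) := by
    rw [← hP]
    ext z
    simp only [mem_filter, mem_univ, true_and, hd, e, decide_eq_true_eq]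
  have hS : 2 ^ (3 + 1) * #((V.image (bxor x₀)).filter fun z => hd z = true) = 2 ^ 11 := by rw [hsupp, h128]; norm_num
  obtain ⟨R₇, hsub, hR0, hRadd, hRcard, hper, hstr⟩ := ffw_minweight_flat (d := 3) (m := 11) V h0 hadd hcardV11 x₀ hd hflat hS
  rw [hsupp] at hRcard hstr
  refine ⟨h128, R₇, hsub, hR0, hRadd, by rw [hRcard, h128], ?_, ?_⟩
  · intro r hr x hx
    have h := hper r hr x ((hmemP x).2 hx)
    have h' : decide (¬ (8 : ℤ) ∣ u' (bxor x r) - 2 * sZ (f (bxor x r)) - sZ (hb (bxor x r))) =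
        decide (¬ (8 : ℤ) ∣ u' x - 2 * sZ (f x) - sZ (hb x)) := h
    constructor
    · intro h1
      have h2 : decide (¬ (8 : ℤ) ∣ u' (bxor x r) - 2 * sZ (f (bxor x r)) - sZ (hb (bxor x r))) = true := decide_eq_true h1
      rw [h'] at h2
      exact of_decide_eq_true h2
    · intro h1
      have h2 : decide (¬ (8 : ℤ) ∣ u' x - 2 * sZ (f x) - sZ (hb x)) = true := decide_eq_true h1
      rw [← h'] at h2
      exact of_decide_eq_true h2
  · intro t ht htL
    exact hstr t ((hmemP t).2 ht) (by simp [hd, e]; exact htL)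

/-! ### Packaging on the open window -/

/-- **The rigid case with `4 ∣ e₅` off the hyperplane, on the open window: `L₅` is a 7-flat (packaging).**  Cubic `f, g` on 12 bits,
`W_g = 32u'` with some `u'` odd, `57/64 < Φ(f,g)`, `4 ∣ e₅` off the odd set and some point of the odd set with `e₅ ≢ σ₅ (mod 8)`.  Then the odd
set is a hyperplane `x₀ ⊕ V` (`#V = 2048`), `L₅` has exactly `128` points and is a coset `t ⊕ R₇` of an xor-closed `R₇ ⊆ V` with `#R₇ = 128`
(for every `t ∈ L₅`), the hyperplane excess `Σ_P (e₅² − 1)` is `≥ 1024`, the off-hyperplane energy is `≤ 511`, and their sum is `≤ 1535`.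
Finite-slice statement, NOT summit progress. [this work] -/
theorem tzq_window_rigid_flat (f g : (Fin (6 + 6) → Bool) → Bool) (hf : IsDegLeFun 3 f) (hg : IsDegLeFun 3 g)
    (u' : (Fin (6 + 6) → Bool) → ℤ) (hu' : ∀ x, W (fun y => signOf (g y)) x = (2 : ℝ) ^ 5 * (u' x : ℝ)) (hodd : ∃ x, Odd (u' x))
    (hlo : (57 / 64 : ℝ) < forrelation f g)
    (h4off : ∀ y, ¬ Odd (u' y) → (4 : ℤ) ∣ u' y - 2 * sZ (f y))
    (hb : (Fin (6 + 6) → Bool) → Bool) (hhb : ∀ z, hb z = decide ((u' z - 2 * sZ (f z)) % 4 = 3))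
    (hL : ∃ x, Odd (u' x) ∧ ¬ (8 : ℤ) ∣ u' x - 2 * sZ (f x) - sZ (hb x)) :
    ∃ (V : Finset (Fin (6 + 6) → Bool)) (x₀ : Fin (6 + 6) → Bool) (R₇ : Finset (Fin (6 + 6) → Bool)),
      zeroVec ∈ V ∧ (∀ a ∈ V, ∀ b ∈ V, bxor a b ∈ V) ∧ #V = 2048 ∧
      (univ.filter fun x : Fin (6 + 6) → Bool => Odd (u' x)) = V.image (bxor x₀) ∧
      R₇ ⊆ V ∧ zeroVec ∈ R₇ ∧ (∀ a ∈ R₇, ∀ b ∈ R₇, bxor a b ∈ R₇) ∧ #R₇ = 128 ∧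
      #(univ.filter fun z : Fin (6 + 6) → Bool => Odd (u' z) ∧ ¬ (8 : ℤ) ∣ u' z - 2 * sZ (f z) - sZ (hb z)) = 128 ∧
      (∀ t, Odd (u' t) → ¬ (8 : ℤ) ∣ u' t - 2 * sZ (f t) - sZ (hb t) →
        (univ.filter fun z : Fin (6 + 6) → Bool => Odd (u' z) ∧ ¬ (8 : ℤ) ∣ u' z - 2 * sZ (f z) - sZ (hb z)) = R₇.image (bxor t)) ∧
      1024 ≤ ∑ x ∈ univ.filter (fun x : Fin (6 + 6) → Bool => Odd (u' x)), ((u' x - 2 * sZ (f x)) ^ 2 - 1) ∧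
      ∑ y ∈ univ.filter (fun y : Fin (6 + 6) → Bool => ¬ Odd (u' y)), (u' y - 2 * sZ (f y)) ^ 2 ≤ 511 ∧
      ∑ x ∈ univ.filter (fun x : Fin (6 + 6) → Bool => Odd (u' x)), ((u' x - 2 * sZ (f x)) ^ 2 - 1) +
        ∑ y ∈ univ.filter (fun y : Fin (6 + 6) → Bool => ¬ Odd (u' y)), (u' y - 2 * sZ (f y)) ^ 2 ≤ 1535 := by
  classical
  obtain ⟨V, x₀, h0, hadd, hcardV, hP, -, -, h191, h1024, h511, htot⟩ :=
    tzr_window_rigid f g hf hg u' hu' hodd hlo h4off hb hhb hL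
  have hPnn : (0 : ℤ) ≤ ∑ y ∈ univ.filter (fun y : Fin (6 + 6) → Bool => ¬ Odd (u' y)), (u' y - 2 * sZ (f y)) ^ 2 :=
    sum_nonneg fun _ _ => sq_nonneg _
  have hbud : ∑ x ∈ univ.filter (fun x : Fin (6 + 6) → Bool => Odd (u' x)), ((u' x - 2 * sZ (f x)) ^ 2 - 1) ≤ 1535 := by linarith
  have hoff : ∑ y ∈ univ.filter (fun y : Fin (6 + 6) → Bool => ¬ Odd (u' y)), (u' y - 2 * sZ (f y)) ^ 2 ≤ 2047 := by linarith
  obtain ⟨h128, R₇, hsub, hR0, hRadd, hRcard, -, hstr⟩ := tzq_L5_flat f g hf hg u' hu' V x₀ h0 hadd hcardV hP h4off hoff hb hhb hbud hL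
  exact ⟨V, x₀, R₇, h0, hadd, hcardV, hP, hsub, hR0, hRadd, hRcard, h128, hstr, h1024, h511, htot⟩

end Summit.QuantumAdvantage.QuantumAdvantage.Theorems.CubicForrelation.NearExactIsExact

end
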